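import Literature.AnabelianGeometry.SemiGraphs.UniversalCoveringOverRigid
import Literature.AnabelianGeometry.SemiGraphs.UniversalCoveringOverMap
import Literature.AnabelianGeometry.SemiGraphs.UniversalCoveringOverBase
import Literature.AnabelianGeometry.SemiGraphs.UniversalCoveringOverDeck

/-!
# `Aut(𝒢_{∞,S})` is transitive on fibres — without connectedness hypothesis ([SemiAnbd] §3 p. 38)

Proof-only refinement of `UniversalCoveringOverTransitive.lean`: the automorphism group of
`𝒢_{∞,S} = univCoverOver S (inl V₀)` acts transitively on every vertex fibre as soon as the
endomorphisms of `S` act transitively on the fibres `S_v` (e.g. `S` Galois) — the connectedness of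
`S` assumed there is not needed: the auxiliary path `σ̄ V₀ ⟶ V₀` of `𝔾_S` can be taken through the
orbit `σ̄ V = V'` reached by the two given points.  [SemiAnbd] p. 38 (`𝒢_{∞,i} → 𝒢` "Galois").
-/

namespace Literature.AnabelianGeometry.SemiGraphs

namespace ProfiniteSemiGraph

open CategoryTheory

universe u

variable {𝒢 : ProfiniteSemiGraph.{u}} (S : CovObj 𝒢) (h𝒢 : 𝒢.IsCountable) (V₀ : S.OVertex)

/-- For every two points of a vertex fibre of `𝒢_{∞,S}` there is an endomorphism of `𝒢_{∞,S}`
mapping the first to the second, provided the endomorphisms of `S` act transitively on `S_v`.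
[cite: MochizukiSemiAnbd2006, Prop 3.6 p.38] -/
theorem CovObj.exists_hom_apply_eq'
    (htrans : ∀ (v : 𝒢.graph.Vertex) (x x' : (S.SV v).obj.V), ∃ σ : S ⟶ S, (σ.fV v).hom.hom x = x')
    {v : 𝒢.graph.Vertex} (t t' : S.FibV (Sum.inl V₀) v) :
    ∃ η : S.univCoverOver (Sum.inl V₀) h𝒢 ⟶ S.univCoverOver (Sum.inl V₀) h𝒢,
      (η.fV v).hom.hom t = t' := by
  obtain ⟨σ, hσ⟩ := htrans v t.2.1.1 t'.2.1.1
  -- the target orbit is `σ̄ V`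
  have hV : CovObj.OVertex.map σ t.1.1 = t'.1.1 := by
    have h1 := congrArg (CovObj.OVertex.map σ) t.2.1.2
    have h2 := t'.2.1.2
    rw [← hσ] at h2
    exact h1.symm.trans h2
  have hb : S.orbitGraph.basept (Sum.inl (CovObj.OVertex.map σ t.1.1)) =
      S.orbitGraph.basept (Sum.inl t'.1.1) := by rw [hV]
  -- a path from `σ̄ V₀` back to `V₀` THROUGH `σ̄ V = V'` (no connectedness needed)
  let q : S.orbitGraph.basept (Sum.inl (CovObj.OVertex.map σ V₀)) ⟶ S.orbitGraph.basept (Sum.inl V₀) :=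
    CovObj.pathMap σ t.2.2 ≫ eqToHom hb ≫ inv t'.2.2
  -- first two moves: `(V, x, p) ↦ (σ̄ V, σ x, q⁻¹ ≫ σ̄ p)`
  let η₁ := CovObj.univCoverOverMap σ (Sum.inl V₀) h𝒢 ≫ S.baseChangeHom q h𝒢
  let γ : S.orbitGraph.FundamentalGroup (Sum.inl V₀) :=
    (inv q ≫ CovObj.pathMap σ t.2.2) ≫ eqToHom hb ≫ inv t'.2.2
  refine ⟨η₁ ≫ S.deckOver (Sum.inl V₀) h𝒢 γ, ?_⟩
  refine CovObj.FibV.ext S _ (Subtype.ext hV) hσ ?_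
  -- the path component: `γ⁻¹ ≫ (q⁻¹ ≫ σ̄ p) = p'`
  change HEq (inv γ ≫ (inv q ≫ CovObj.pathMap σ t.2.2)) t'.2.2
  have aux : ∀ (W : S.OVertex) (e : CovObj.OVertex.map σ t.1.1 = W)
      (hb' : S.orbitGraph.basept (Sum.inl (CovObj.OVertex.map σ t.1.1)) =
        S.orbitGraph.basept (Sum.inl W))
      (p' : S.orbitGraph.basept (Sum.inl V₀) ⟶ S.orbitGraph.basept (Sum.inl W)),
      HEq (inv ((inv q ≫ CovObj.pathMap σ t.2.2) ≫ eqToHom hb' ≫ inv p') ≫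
        (inv q ≫ CovObj.pathMap σ t.2.2)) p' := by
    intro W e hb' p'
    subst e
    apply heq_of_eq
    have hid : (eqToHom hb' : S.orbitGraph.basept (Sum.inl (CovObj.OVertex.map σ t.1.1)) ⟶ _) = 𝟙 _ :=
      eqToHom_refl _ _
    have e1 : eqToHom hb' ≫ inv p' = inv p' :=
      (congrArg (· ≫ inv p') hid).trans (Category.id_comp _)
    have e2 : inv ((inv q ≫ CovObj.pathMap σ t.2.2) ≫ eqToHom hb' ≫ inv p') =
        p' ≫ inv (inv q ≫ CovObj.pathMap σ t.2.2) := by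
      refine (congrArg (fun z => inv ((inv q ≫ CovObj.pathMap σ t.2.2) ≫ z)) e1).trans ?_
      exact IsIso.inv_comp.trans (congrArg (· ≫ inv (inv q ≫ CovObj.pathMap σ t.2.2))
        (IsIso.inv_inv (f := p')))
    refine (congrArg (· ≫ (inv q ≫ CovObj.pathMap σ t.2.2)) e2).trans ?_
    exact (Category.assoc _ _ _).trans
      ((congrArg (p' ≫ ·) (IsIso.inv_hom_id _)).trans (Category.comp_id p'))
  exact aux _ hV hb _

/-- **`Aut(𝒢_{∞,S})` acts transitively on every vertex fibre of `𝒢_{∞,S}`** as soon as the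
endomorphisms of `S` act transitively on the fibres of `S` (e.g. `S` a Galois finite étale
covering). [cite: MochizukiSemiAnbd2006, Prop 3.6 p.38] -/
theorem CovObj.exists_aut_apply_eq'
    (htrans : ∀ (v : 𝒢.graph.Vertex) (x x' : (S.SV v).obj.V), ∃ σ : S ⟶ S, (σ.fV v).hom.hom x = x')
    {v : 𝒢.graph.Vertex} (t t' : S.FibV (Sum.inl V₀) v) :
    ∃ η : S.univCoverOver (Sum.inl V₀) h𝒢 ≅ S.univCoverOver (Sum.inl V₀) h𝒢,
      (η.hom.fV v).hom.hom t = t' := by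
  obtain ⟨η₁, h₁⟩ := S.exists_hom_apply_eq' h𝒢 V₀ htrans t t'
  obtain ⟨η₂, h₂⟩ := S.exists_hom_apply_eq' h𝒢 V₀ htrans t' t
  refine ⟨⟨η₁, η₂, ?_, ?_⟩, h₁⟩
  · refine S.univCoverOver_hom_ext _ h𝒢 _ _ t ?_
    change (η₂.fV v).hom.hom ((η₁.fV v).hom.hom t) = t
    rw [h₁, h₂]
  · refine S.univCoverOver_hom_ext _ h𝒢 _ _ t' ?_
    change (η₁.fV v).hom.hom ((η₂.fV v).hom.hom t') = t'
    rw [h₂, h₁]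

end ProfiniteSemiGraph

end Literature.AnabelianGeometry.SemiGraphs
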